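import Summits.ResolutionOfSingularities.ResolutionOfSingularities.Theorems.FrobeniusClosingPatchingRelPerfectDepthOneExceptionalFormat
import HarnessLib

/-!
# Crux `PatchingRelPerfect` (stmt-ResolutionOfSingularities-16161), chain w52 — R4 support:
# the `k`-LAYER FORMAT on the first blowing up, globally and chart-free

[OURS · L1 W5.2 · rung tool] Companion of `…DepthOneExceptionalFormat.lean` (res-L1-w52-stub-3, p493964,
`DepthOne.depthOne_format`, the case `k = 1`) for the multi-layer packages of the next rungs (CHAIN.md v1.5
§1 (A): R4 = r-d2¹, two-layer one-form ideals `(F) + 𝔪^{d+2}`, `(F) + (x_i^{d+2})`): let `S` be a local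
ring, `x = (x₁, …, x_n)` any family spanning `𝔪`, `g : X ⟶ Spec S` any blowing up along `𝔪~` with
exceptional ideal `𝓘_E = 𝔪𝒪_X`, and `I ⊆ 𝔪ᵈ` an ideal with `x_i^{d+k} ∈ I` for every `i` (depth `≤ k`).
PROVED, without charts:

* `DepthOne.layered_format` — with `M = 𝓘_Eᵈ` (effective Cartier) and `K = (I𝒪_X : 𝓘_Eᵈ)`
  (`controlledTransform g 𝔪~ I~ d`): `I𝒪_X = M · K` and **`𝓘_E^k ≤ K`** (`𝓘_E^{d+k} = (x_i^{d+k})𝒪_X ≤ I𝒪_X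
  = 𝓘_Eᵈ · K`, cancel `𝓘_Eᵈ`) — on a chart `K ∋ w^k`, the starting format of a `k`-layer dictionary (for
  `k = 2`: `K = (w²) + w·𝔟̂₁ + 𝔟̂₀`), matching the hypothesis `𝓘_E^μ ≤ K` of `DepthOne.dictionaryStep_pow`.

Every local ring `S`; fact-free; nothing here is a statement of the manuscript under review.

## References

* U. Görtz, T. Wedhorn, *Algebraic Geometry I*, 2nd ed. (2020), Prop. 13.91 (1), (13.19). [GortzWedhorn2020]
* E. Bierstone, D. Grigoriev, P. Milman, J. Włodarczyk (2011), §3.2 Lemma 3.2.1. [BierstoneGrigorievMilmanWlodarczyk2011]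
-/

-- `Summit.<Summit>.<Sub>.Theorems` with `Sub = Summit` (single-conjunct summit, D-0017)
set_option linter.dupNamespace false

noncomputable section

open CategoryTheory CategoryTheory.Limits AlgebraicGeometry Literature.AlgebraicGeometry.Resolution
open IsLocalRing

namespace Summit.ResolutionOfSingularities.ResolutionOfSingularities.Theorems

namespace DepthOne

universe u

variable {S : Type u} [CommRing S] {n : ℕ} (x : Fin n → S) {𝔪 : Ideal S}
  (hx : Ideal.span (Set.range x) = 𝔪) {X : Scheme.{u}} {g : X ⟶ Spec (.of S)}
  (hg : IsBlowup g (affineBlowup.idealSheaf 𝔪))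

include hx hg in
/-- **The `k`-layer format of an ideal of exceptional depth `≤ k` on the first blowing up** (global form
of `I𝒪 = wᵈ · ((wᵏ) + …)`): for `I ⊆ 𝔪ᵈ` with `x_i^{d+k} ∈ I` for all `i`, `𝓘_Eᵈ` is an effective
Cartier divisor, `𝓘_Eᵏ ≤ K := (I𝒪_X : 𝓘_Eᵈ)`, and `I𝒪_X = 𝓘_Eᵈ · K`. The case `k = 1` is
`DepthOne.depthOne_format`. [cite: GortzWedhorn2020, Prop. 13.91 (1)]
[cite: BierstoneGrigorievMilmanWlodarczyk2011, §3.2 Lemma 3.2.1] -/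
theorem layered_format {I : Ideal S} {d k : ℕ} (hk : 0 < k) (hId : I ≤ 𝔪 ^ d)
    (hxI : ∀ i, x i ^ (d + k) ∈ I) :
    IsEffectiveCartier ((affineBlowup.idealSheaf 𝔪).comap g ^ d) ∧
      (affineBlowup.idealSheaf 𝔪).comap g ^ k ≤
        controlledTransform g (affineBlowup.idealSheaf 𝔪) (affineBlowup.idealSheaf I) d ∧
      (affineBlowup.idealSheaf I).comap g = (affineBlowup.idealSheaf 𝔪).comap g ^ d *
        controlledTransform g (affineBlowup.idealSheaf 𝔪) (affineBlowup.idealSheaf I) d := by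
  have hEd : IsEffectiveCartier ((affineBlowup.idealSheaf 𝔪).comap g ^ d) :=
    hg.isEffectiveCartier.pow d
  have hle : (affineBlowup.idealSheaf I).comap g ≤ (affineBlowup.idealSheaf 𝔪).comap g ^ d := by
    rw [← comap_pow, ← idealSheaf_pow]
    exact Scheme.IdealSheafData.comap_mono g (affineBlowup.idealSheaf_le_idealSheaf_iff.mpr hId)
  have hfmt := hg.pow_mul_controlledTransform_eq hle
  refine ⟨hEd, ?_, hfmt.symm⟩
  -- `𝓘_E^{d+k} = (x_i^{d+k})𝒪 ≤ I𝒪 = 𝓘_E^d · K`; cancel `𝓘_E^d`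
  apply hEd.le_of_mul_le_mul
  rw [← pow_add, hfmt, ← comap_idealSheaf_span_powers_eq_pow x hx hg (show 1 ≤ d + k by omega)]
  refine Scheme.IdealSheafData.comap_mono g (affineBlowup.idealSheaf_le_idealSheaf_iff.mpr ?_)
  rw [Ideal.span_le]
  rintro _ ⟨i, rfl⟩
  exact hxI i

include hx hg in
/-- **The two-layer format** (`k = 2`, the R4 = r-d2¹ starting point: `I ⊆ 𝔪ᵈ`, `x_i^{d+2} ∈ I`, e.g.
`I = (F) + 𝔪^{d+2}` or `(F) + (x_i^{d+2})` with `F ∈ 𝔪ᵈ`): `𝓘_E² ≤ K` and `I𝒪_X = 𝓘_Eᵈ · K`.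
[cite: GortzWedhorn2020, Prop. 13.91 (1)] [cite: BierstoneGrigorievMilmanWlodarczyk2011, §3.2 Lemma 3.2.1] -/
theorem twoLayer_format {I : Ideal S} {d : ℕ} (hId : I ≤ 𝔪 ^ d) (hxI : ∀ i, x i ^ (d + 2) ∈ I) :
    IsEffectiveCartier ((affineBlowup.idealSheaf 𝔪).comap g ^ d) ∧
      (affineBlowup.idealSheaf 𝔪).comap g ^ 2 ≤
        controlledTransform g (affineBlowup.idealSheaf 𝔪) (affineBlowup.idealSheaf I) d ∧
      (affineBlowup.idealSheaf I).comap g = (affineBlowup.idealSheaf 𝔪).comap g ^ d *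
        controlledTransform g (affineBlowup.idealSheaf 𝔪) (affineBlowup.idealSheaf I) d :=
  layered_format x hx hg two_pos hId hxI

end DepthOne

end Summit.ResolutionOfSingularities.ResolutionOfSingularities.Theorems

end
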